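import Summits.KontsevichZagierPeriods.KontsevichZagierPeriods.Theorems.TerasomaMultiplicationBetaCancellationStubWeightExists
import Literature.NumberTheory.Transcendental.KZLogCalculusProofs

/-!
# `BetaCancellation` (stmt-KontsevichZagierPeriods-13633), line `dirichlet-companion-to-pi`: stub `stub_weight2Exists`

For a bounded `ℚ`-semialgebraic weight `h : ℝ → ℝ → ℝ` of two real variables and an integral
representation `r = [t, f]` of dimension `k + 2 ≥ 2`, the weighted companion
`[t, h (z 0) (z 1) · f]` is again an integral representation: the integrand `z ↦ h (z 0) (z 1)` is
`ℚ`-semialgebraic on `ℝ^{k+2}` (coordinate preimage of the graph of `(x, y) ↦ h x y`, no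
Tarski–Seidenberg needed), the product of two semialgebraic functions is semialgebraic, a real
semialgebraic function is a.e. strongly measurable on a measurable set, and a bounded
a.e.-strongly-measurable function times an integrable one is integrable
(`MeasureTheory.Integrable.bdd_mul`). This is the input of the two-coordinate multiplier operator
`M_h [t, f] = [t, h (z 0) (z 1) · f]` of the weight-descent line (the one-coordinate version is
`stub_weightExists`).
-/

noncomputable section

set_option linter.dupNamespace false

namespace Summit.KontsevichZagierPeriods.KontsevichZagierPeriods.BetaCancellationLine

open Set
open MeasureTheory
open Literature.NumberTheory.Transcendental
open Literature.NumberTheory.Transcendental.KZ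

-- adapted from Summits/KontsevichZagierPeriods/KontsevichZagierPeriods/Theorems/TerasomaMultiplicationBetaCancellationStubWeightExists.lean
-- (`weightExists_isSemialgebraicFunOn_coord`, `stub_weightExists`)

/-- If `x ↦ h (x 0) (x 1)` is `ℚ`-semialgebraic on `ℝ²`, then `x ↦ h (x i) (x j)` is
`ℚ`-semialgebraic on all of `ℝⁿ`: its graph is the preimage of the graph of `(u, v) ↦ h u v` under
the coordinate map `z ↦ (z (castSucc i), z (castSucc j), z last)`. [folklore] -/
theorem weight2Exists_isSemialgebraicFunOn_coord {h : ℝ → ℝ → ℝ}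
    (hh : IsSemialgebraicFunOn ℚ (Set.univ : Set (Fin 2 → ℝ)) (fun x => h (x 0) (x 1)))
    {n : ℕ} (i j : Fin n) :
    IsSemialgebraicFunOn ℚ (Set.univ : Set (Fin n → ℝ)) (fun x => h (x i) (x j)) := by
  rw [isSemialgebraicFunOn_iff] at hh ⊢
  convert hh.preimage_comp ![Fin.castSucc i, Fin.castSucc j, Fin.last n] using 1
  ext z
  simp only [mem_univ, true_and, mem_setOf_eq, mem_preimage]
  have h1 : (z ∘ ![Fin.castSucc i, Fin.castSucc j, Fin.last n]) (Fin.last 2) = z (Fin.last n) := by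
    simp
  have h2 : Fin.init (z ∘ ![Fin.castSucc i, Fin.castSucc j, Fin.last n]) 0 = z (Fin.castSucc i) := by
    simp [Fin.init]
  have h3 : Fin.init (z ∘ ![Fin.castSucc i, Fin.castSucc j, Fin.last n]) 1 = z (Fin.castSucc j) := by
    simp [Fin.init]
  rw [h1, h2, h3]
  rfl

/-- **Two-coordinate weighted representations exist**: for a bounded `ℚ`-semialgebraic weight `h`
of two real variables, every representation `[t, f]` of dimension `≥ 2` has the companion
`[t, h (z 0) (z 1) · f]` (semialgebraic as a product of semialgebraic functions, integrable as
bounded a.e.-strongly-measurable × integrable). [folklore] -/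
theorem stub_weight2Exists :
    ∀ (h : ℝ → ℝ → ℝ), IsSemialgebraicFunOn ℚ (Set.univ : Set (Fin 2 → ℝ)) (fun x => h (x 0) (x 1)) →
    ∀ (B : ℝ), (∀ u v : ℝ, |h u v| ≤ B) →
    ∀ (k : ℕ) (r : IntegralRep (k + 2)),
      ∃ s : IntegralRep (k + 2), s.domain = r.domain ∧
        s.integrand = fun z => h (z 0) (z 1) * r.integrand z := by
  intro h hh B hB k r
  have hW : IsSemialgebraicFunOn ℚ r.domain (fun z : Fin (k + 2) → ℝ => h (z 0) (z 1)) :=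
    (weight2Exists_isSemialgebraicFunOn_coord hh (0 : Fin (k + 2)) 1).mono (subset_univ _)
      r.isSemialgebraic_domain
  have hsa : IsSemialgebraicFunOn ℚ r.domain
      (fun z : Fin (k + 2) → ℝ => h (z 0) (z 1) * r.integrand z) :=
    IsSemialgebraicFunOn.mul_holds hW r.isSemialgebraicFunOn_integrand
  have hmeas : AEStronglyMeasurable (fun z : Fin (k + 2) → ℝ => h (z 0) (z 1))
      (volume.restrict r.domain) :=
    KZ.aestronglyMeasurable_of_isSemialgebraicFunOn hW (IntegralRep.measurableSet_domain_holds r)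
  have hint : IntegrableOn (fun z : Fin (k + 2) → ℝ => h (z 0) (z 1) * r.integrand z) r.domain :=
    r.integrableOn.bdd_mul hmeas (c := B) (Filter.Eventually.of_forall fun z => by
      rw [Real.norm_eq_abs]
      exact hB _ _)
  exact ⟨⟨r.domain, fun z => h (z 0) (z 1) * r.integrand z, r.isSemialgebraic_domain, hsa, hint⟩,
    rfl, rfl⟩

end Summit.KontsevichZagierPeriods.KontsevichZagierPeriods.BetaCancellationLine

end
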